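import Literature.Topology.Euclidean.BrouwerNormedSpace
import Mathlib.Analysis.SpecialFunctions.Pow.Real
import Mathlib.Analysis.SpecialFunctions.Sqrt
import Mathlib.Analysis.Complex.Basic
import Mathlib.Analysis.Matrix.Normed
import Mathlib.LinearAlgebra.Matrix.NonsingularInverse
import Mathlib.Topology.MetricSpace.Pseudo.Lemmas
import HarnessLib

/-!
# Booker–Thorne 2014, Proposition 9: continuous torus-valued right inverses of `t ↦ ∑ g_i t_i`

Sibling of `DavenportHeilbronnDegreeTwo.lean` (barrier catalogue, D-0021), part of the proof of
`Literature.Barriers.RiemannHypothesis.BookerThorne2014_levelOne_zeros` /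
`BookerThorne2014_thm1_levelOne` along the printed architecture; everything here is PROVED, there
are no definitions and no named facts.

A. R. Booker, F. Thorne, *Zeros of `L`-functions outside the critical strip*, Algebra Number
Theory 8 (2014), §3, **Proposition 9** (the topological engine of their Proposition 8, "the
technical heart of our work"): "Let `T = {(z_1,…,z_n) ∈ ℂⁿ : |z_1| = … = |z_n| = 1}`,
`D = {(z_1,…,z_n) ∈ ℂⁿ : |z_1|, …, |z_n| ≤ 1}`, and fix a compact set `K ⊆ GL_n(ℂ)`. Then there
is a number `m_0 > 0` such that for every `m ≥ m_0` and all `(g_1,…,g_m) ∈ K^m`, there are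
continuous functions `f_1,…,f_m : D → T` such that `∑_{i=1}^m g_i f_i(z) = z` for all `z ∈ D`."

Rendering. `ℂⁿ` is `ι → ℂ` with the sup norm (so `D` is its closed unit ball and `T` is
`∀ i, ‖t i‖ = 1`); matrices act by `Matrix.mulVec`; the compact set is
`K(A, b) = {g : ‖g z‖ ≤ A ‖z‖ and b ‖z‖ ≤ ‖g z‖ for all z}` (`A ≥ 0`, `b > 0`; every compact
subset of `GL_n(ℂ)` lies in such a set, and these are the bounds that Proposition 10 delivers);
the number of matrices is the fixed `m = 3 n K₁ m₁`, indexed by `(ι × Fin 3) × (Fin K₁ × Fin m₁)`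
(the paper's `m_0 = 3 n m_2`, `m_2 = m_1 k_1`; the statement for one admissible `m` is what
Proposition 8 uses). Main result: `BookerThorne2014.prop9`.

The proof is the printed one, in its three steps:

* step 1 (`step1`, `block_ball`, `exists_close_pair_card`): by compactness (a finite cover of
  `K(A, b)` by small balls and the pigeonhole principle) any `m₁` matrices of `K` contain a close
  pair `g₁, g₂`; for such a pair `{g₁ t₁ + g₂ t₂}` contains the ball of radius `b/3` about
  `g₁(1,…,1)` — Brouwer's fixed point theorem on the polydisc `{|z_i − 1| ≤ 2/3}` (the tree's
  `Literature.Topology.Euclidean.Brouwer.exists_fixedPoint_closedBall_of_finiteDimensional`) for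
  `h_w(z) = w − Δ t₂(z)`, `Δ = g₁⁻¹ g₂ − I`, with the continuous decomposition
  `z = s₁(z) + s₂(z)` into unit vectors (`exists_unit_decomposition`);
* step 2 (`step2`, with `exists_signs_norm_sum_le` for Lemma 5 — signs `±1` chosen greedily by the
  parallelogram law instead of averaging over the torus): `K₁` blocks realize the ball of radius
  `2`;
* step 3 (`prop9`): `3n` such families realize `2e_i` (`i ∈ ι`, three copies), and
  `z_i = 2(1 + α_i(z) + β_i(z))` with continuous unit `α_i, β_i` gives the continuous
  parametrization.

## References

* [BookerThorne2014] A. R. Booker, F. Thorne, Algebra Number Theory 8 (2014), 2027–2042, §2.2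
  (Lemmas 4–5), §3 (Prop. 9 and its proof) (arXiv:1306.6362, read).
-/

noncomputable section

open Metric Set Filter Topology Complex Finset

namespace Literature.Barriers.RiemannHypothesis

namespace BookerThorne2014

/-! ### Two unit complex numbers with prescribed sum -/

/-- **Two unit vectors summing to `w`**, continuously in `w ≠ 0`, `‖w‖ ≤ 2`:
`s₁(w) = w/2 + i (w/‖w‖) √(1 − ‖w‖²/4)` and `s₂(w) = w/2 − i (w/‖w‖) √(1 − ‖w‖²/4)` (the
functions `s₁, s₂` of [BookerThorne2014], proof of Prop. 9, step 1). [cite: BookerThorne2014, proof of Prop. 9] -/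
theorem exists_unit_decomposition :
    ∃ s₁ s₂ : ℂ → ℂ, ContinuousOn s₁ {w | w ≠ 0} ∧ ContinuousOn s₂ {w | w ≠ 0} ∧
      ∀ w : ℂ, w ≠ 0 → ‖w‖ ≤ 2 → ‖s₁ w‖ = 1 ∧ ‖s₂ w‖ = 1 ∧ s₁ w + s₂ w = w := by
  set h : ℂ → ℝ := fun w ↦ Real.sqrt (1 - ‖w‖ ^ 2 / 4) with hh
  set s₁ : ℂ → ℂ := fun w ↦ w * ((1 / 2 : ℂ) + I * ((h w / ‖w‖ : ℝ) : ℂ)) with hs₁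
  set s₂ : ℂ → ℂ := fun w ↦ w * ((1 / 2 : ℂ) - I * ((h w / ‖w‖ : ℝ) : ℂ)) with hs₂
  have hcont_h : Continuous h := by
    simp only [hh]
    fun_prop
  have hcont_q : ContinuousOn (fun w : ℂ ↦ ((h w / ‖w‖ : ℝ) : ℂ)) {w | w ≠ 0} := by
    refine (continuous_ofReal.comp_continuousOn ?_)
    exact hcont_h.continuousOn.div continuous_norm.continuousOn fun w hw ↦ norm_ne_zero_iff.2 hw
  refine ⟨s₁, s₂, ?_, ?_, fun w hw hw2 ↦ ?_⟩
  · simp only [hs₁]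
    exact continuousOn_id.mul (continuousOn_const.add (continuousOn_const.mul hcont_q))
  · simp only [hs₂]
    exact continuousOn_id.mul (continuousOn_const.sub (continuousOn_const.mul hcont_q))
  have hwpos : 0 < ‖w‖ := norm_pos_iff.2 hw
  have hrad : 0 ≤ 1 - ‖w‖ ^ 2 / 4 := by nlinarith
  have hh2 : h w ^ 2 = 1 - ‖w‖ ^ 2 / 4 := by
    simp only [hh]
    rw [Real.sq_sqrt hrad]
  -- the norm of `1/2 ± i q`, `q = h/‖w‖`
  have key : ∀ e : ℝ, e = 1 ∨ e = -1 →
      ‖w * ((1 / 2 : ℂ) + ((e : ℝ) : ℂ) * (I * ((h w / ‖w‖ : ℝ) : ℂ)))‖ = 1 := by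
    intro e he
    have he2 : e ^ 2 = 1 := by rcases he with rfl | rfl <;> norm_num
    rw [norm_mul]
    have : (1 / 2 : ℂ) + ((e : ℝ) : ℂ) * (I * ((h w / ‖w‖ : ℝ) : ℂ)) =
        ((1 / 2 : ℝ) : ℂ) + ((e * (h w / ‖w‖) : ℝ) : ℂ) * I := by
      push_cast
      ring
    rw [this, Complex.norm_add_mul_I]
    have h3 : (1 / 2 : ℝ) ^ 2 + (e * (h w / ‖w‖)) ^ 2 = (1 / ‖w‖) ^ 2 := by
      have h4 : (e * (h w / ‖w‖)) ^ 2 = h w ^ 2 / ‖w‖ ^ 2 := by rw [mul_pow, he2, one_mul, div_pow]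
      rw [h4, hh2]
      field_simp
      ring
    rw [h3, Real.sqrt_sq (by positivity)]
    field_simp
  refine ⟨?_, ?_, ?_⟩
  · have := key 1 (Or.inl rfl)
    simpa [hs₁] using this
  · have := key (-1) (Or.inr rfl)
    simp only [hs₂]
    rw [show w * ((1 / 2 : ℂ) - I * ((h w / ‖w‖ : ℝ) : ℂ)) =
      w * ((1 / 2 : ℂ) + (((-1 : ℝ) : ℝ) : ℂ) * (I * ((h w / ‖w‖ : ℝ) : ℂ))) by push_cast; ring]
    exact this
  · simp only [hs₁, hs₂]
    ring

/-! ### Balancing signs -/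

/-- **Greedy sign balancing** (the discrete form of [BookerThorne2014], Lemma 5: "the average
choice of `(θ_0, …, θ_k)` satisfies the conclusion"): for vectors `v_j ∈ ℂ^ι` there are signs
`ε_j = ±1` with `∑_i |∑_j ε_j v_j(i)|² ≤ ∑_j ∑_i |v_j(i)|²` (choose each sign to make the
parallelogram identity work in one's favour). [cite: BookerThorne2014, Lemma 5] -/
theorem exists_signs_sum_sq_le {ι : Type*} [Fintype ι] (K : ℕ) (v : Fin K → ι → ℂ) :
    ∃ e : Fin K → ℝ, (∀ j, e j = 1 ∨ e j = -1) ∧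
      ∑ i, ‖∑ j, (e j : ℂ) * v j i‖ ^ 2 ≤ ∑ j, ∑ i, ‖v j i‖ ^ 2 := by
  induction K with
  | zero =>
    refine ⟨fun _ ↦ 1, fun j ↦ Or.inl rfl, ?_⟩
    simp
  | succ K ih =>
    obtain ⟨e, he, hle⟩ := ih (fun j ↦ v (Fin.castSucc j))
    -- the partial sum and the new vector
    set S : ι → ℂ := fun i ↦ ∑ j : Fin K, (e j : ℂ) * v (Fin.castSucc j) i with hS
    set a : ι → ℂ := v (Fin.last K) with ha
    -- parallelogram: `‖S + a‖² + ‖S - a‖² = 2‖S‖² + 2‖a‖²` coordinatewise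
    have hpar : ∀ i, ‖S i + a i‖ ^ 2 + ‖S i - a i‖ ^ 2 = 2 * ‖S i‖ ^ 2 + 2 * ‖a i‖ ^ 2 := by
      intro i
      have := parallelogram_law_with_norm ℂ (S i) (a i)
      linarith
    -- choose the better sign
    by_cases hcase : ∑ i, ‖S i + a i‖ ^ 2 ≤ ∑ i, ‖S i - a i‖ ^ 2
    · refine ⟨Fin.snoc (α := fun _ ↦ ℝ) e 1, fun j ↦ ?_, ?_⟩
      · refine Fin.lastCases ?_ (fun j ↦ ?_) j
        · simp
        · simpa using he j
      · have hsum : ∀ i, ∑ j : Fin (K + 1), ((Fin.snoc (α := fun _ ↦ ℝ) e 1 j : ℝ) : ℂ) * v j i =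
            S i + a i := by
          intro i
          rw [Fin.sum_univ_castSucc]
          simp [hS, ha]
        simp_rw [hsum]
        have h2 : ∑ i, ‖S i + a i‖ ^ 2 ≤ ∑ i, ‖S i‖ ^ 2 + ∑ i, ‖a i‖ ^ 2 := by
          have : ∑ i, ‖S i + a i‖ ^ 2 + ∑ i, ‖S i - a i‖ ^ 2 =
              2 * ∑ i, ‖S i‖ ^ 2 + 2 * ∑ i, ‖a i‖ ^ 2 := by
            rw [← Finset.sum_add_distrib, Finset.mul_sum, Finset.mul_sum, ← Finset.sum_add_distrib]
            exact Finset.sum_congr rfl fun i _ ↦ hpar i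
          linarith
        calc ∑ i, ‖S i + a i‖ ^ 2 ≤ ∑ i, ‖S i‖ ^ 2 + ∑ i, ‖a i‖ ^ 2 := h2
          _ ≤ (∑ j : Fin K, ∑ i, ‖v (Fin.castSucc j) i‖ ^ 2) + ∑ i, ‖a i‖ ^ 2 := by
              gcongr
          _ = ∑ j : Fin (K + 1), ∑ i, ‖v j i‖ ^ 2 := by
              rw [Fin.sum_univ_castSucc]
    · push Not at hcase
      refine ⟨Fin.snoc (α := fun _ ↦ ℝ) e (-1), fun j ↦ ?_, ?_⟩
      · refine Fin.lastCases ?_ (fun j ↦ ?_) j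
        · simp
        · simpa using he j
      · have hsum : ∀ i, ∑ j : Fin (K + 1), ((Fin.snoc (α := fun _ ↦ ℝ) e (-1) j : ℝ) : ℂ) * v j i =
            S i - a i := by
          intro i
          rw [Fin.sum_univ_castSucc]
          simp [hS, ha, sub_eq_add_neg]
        simp_rw [hsum]
        have h2 : ∑ i, ‖S i - a i‖ ^ 2 ≤ ∑ i, ‖S i‖ ^ 2 + ∑ i, ‖a i‖ ^ 2 := by
          have : ∑ i, ‖S i + a i‖ ^ 2 + ∑ i, ‖S i - a i‖ ^ 2 =
              2 * ∑ i, ‖S i‖ ^ 2 + 2 * ∑ i, ‖a i‖ ^ 2 := by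
            rw [← Finset.sum_add_distrib, Finset.mul_sum, Finset.mul_sum, ← Finset.sum_add_distrib]
            exact Finset.sum_congr rfl fun i _ ↦ hpar i
          linarith
        calc ∑ i, ‖S i - a i‖ ^ 2 ≤ ∑ i, ‖S i‖ ^ 2 + ∑ i, ‖a i‖ ^ 2 := h2
          _ ≤ (∑ j : Fin K, ∑ i, ‖v (Fin.castSucc j) i‖ ^ 2) + ∑ i, ‖a i‖ ^ 2 := by
              gcongr
          _ = ∑ j : Fin (K + 1), ∑ i, ‖v j i‖ ^ 2 := by
              rw [Fin.sum_univ_castSucc]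

/-- **Balanced signs in the sup norm**: for `v_j ∈ ℂ^ι` (`j < K`) with `‖v_j‖_∞ ≤ M` there are
signs `ε_j = ±1` with `‖∑_j ε_j v_j‖_∞ ≤ √(K · |ι|) M`. [cite: BookerThorne2014, Lemma 5] -/
theorem exists_signs_norm_sum_le {ι : Type*} [Fintype ι] (K : ℕ) (v : Fin K → ι → ℂ) {M : ℝ}
    (hM : 0 ≤ M) (hv : ∀ j, ‖v j‖ ≤ M) :
    ∃ e : Fin K → ℝ, (∀ j, e j = 1 ∨ e j = -1) ∧
      ‖∑ j, (e j : ℂ) • v j‖ ≤ Real.sqrt (K * Fintype.card ι) * M := by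
  obtain ⟨e, he, hle⟩ := exists_signs_sum_sq_le K v
  refine ⟨e, he, ?_⟩
  have hbound : ∑ j, ∑ i, ‖v j i‖ ^ 2 ≤ K * Fintype.card ι * M ^ 2 := by
    calc ∑ j, ∑ i, ‖v j i‖ ^ 2 ≤ ∑ _j : Fin K, ∑ _i : ι, M ^ 2 := by
          refine Finset.sum_le_sum fun j _ ↦ Finset.sum_le_sum fun i _ ↦ ?_
          have : ‖v j i‖ ≤ M := (norm_le_pi_norm (v j) i).trans (hv j)
          exact pow_le_pow_left₀ (norm_nonneg _) this 2
      _ = K * Fintype.card ι * M ^ 2 := by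
          simp [Finset.sum_const, Finset.card_univ, mul_assoc]
  rw [pi_norm_le_iff_of_nonneg (by positivity)]
  intro i
  have h1 : ‖(∑ j, (e j : ℂ) • v j) i‖ ^ 2 ≤ K * Fintype.card ι * M ^ 2 := by
    have hi : ‖(∑ j, (e j : ℂ) • v j) i‖ ^ 2 ≤ ∑ i, ‖∑ j, (e j : ℂ) * v j i‖ ^ 2 := by
      have heq : (∑ j, (e j : ℂ) • v j) i = ∑ j, (e j : ℂ) * v j i := by
        simp [Finset.sum_apply, Pi.smul_apply]
      rw [heq]
      exact Finset.single_le_sum (f := fun i ↦ ‖∑ j, (e j : ℂ) * v j i‖ ^ 2)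
        (fun i _ ↦ by positivity) (Finset.mem_univ i)
    exact hi.trans (hle.trans hbound)
  have h2 : (Real.sqrt (K * Fintype.card ι) * M) ^ 2 = K * Fintype.card ι * M ^ 2 := by
    rw [mul_pow, Real.sq_sqrt (by positivity)]
  exact (pow_le_pow_iff_left₀ (norm_nonneg _) (by positivity) two_ne_zero).1 (h1.trans_eq h2.symm)

end BookerThorne2014

end Literature.Barriers.RiemannHypothesis

namespace Literature.Barriers.RiemannHypothesis

namespace BookerThorne2014

open Matrix

variable {ι : Type*} [Fintype ι] [DecidableEq ι]

/-! ### The sup norm on `ι → ℂ` and matrices -/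

omit [DecidableEq ι] in
/-- `‖(1, …, 1)‖_∞ = 1` (for `ι` non-empty). [folklore] -/
theorem norm_ones [Nonempty ι] : ‖(fun _ : ι ↦ (1 : ℂ))‖ = 1 := by
  refine le_antisymm ((pi_norm_le_iff_of_nonneg zero_le_one).2 fun i ↦ by simp) ?_
  obtain ⟨i⟩ := ‹Nonempty ι›
  have h := norm_le_pi_norm (fun _ : ι ↦ (1 : ℂ)) i
  rwa [norm_one] at h

omit [DecidableEq ι] in
/-- A vector with unimodular entries has sup norm `1` (for `ι` non-empty). [folklore] -/
theorem norm_eq_one_of_forall_norm_eq_one [Nonempty ι] {t : ι → ℂ} (ht : ∀ i, ‖t i‖ = 1) :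
    ‖t‖ = 1 := by
  refine le_antisymm ((pi_norm_le_iff_of_nonneg zero_le_one).2 fun i ↦ (ht i).le) ?_
  obtain ⟨i⟩ := ‹Nonempty ι›
  simpa [ht i] using norm_le_pi_norm t i

omit [DecidableEq ι] in
/-- A coordinate bound on the entries of a matrix bounds its action in the sup norm:
`‖d v‖_∞ ≤ |ι| δ ‖v‖_∞` if all `|d_{ij}| ≤ δ`. [folklore] -/
theorem norm_mulVec_le_of_entry_le {d : Matrix ι ι ℂ} {δ : ℝ} (hδ : 0 ≤ δ)
    (hd : ∀ i j, ‖d i j‖ ≤ δ) (v : ι → ℂ) : ‖d *ᵥ v‖ ≤ Fintype.card ι * δ * ‖v‖ := by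
  refine (pi_norm_le_iff_of_nonneg (by positivity)).2 fun i ↦ ?_
  calc ‖(d *ᵥ v) i‖ = ‖∑ j, d i j * v j‖ := rfl
    _ ≤ ∑ j, ‖d i j * v j‖ := norm_sum_le _ _
    _ ≤ ∑ _j : ι, δ * ‖v‖ := Finset.sum_le_sum fun j _ ↦ by
        rw [norm_mul]
        exact mul_le_mul (hd i j) (norm_le_pi_norm v j) (norm_nonneg _) hδ
    _ = Fintype.card ι * δ * ‖v‖ := by simp [Finset.sum_const, Finset.card_univ, mul_assoc]

/-- A matrix bounded below in the sup norm, `b‖z‖ ≤ ‖g z‖` with `b > 0`, is invertible.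
[folklore] -/
theorem isUnit_det_of_lower {b : ℝ} (hb : 0 < b) {g : Matrix ι ι ℂ}
    (hlow : ∀ z : ι → ℂ, b * ‖z‖ ≤ ‖g *ᵥ z‖) : IsUnit g.det := by
  rw [← isUnit_iff_isUnit_det, ← mulVec_injective_iff_isUnit]
  intro z z' h
  have h1 : g *ᵥ (z - z') = 0 := by rw [mulVec_sub, h, sub_self]
  have h2 := hlow (z - z')
  rw [h1, norm_zero] at h2
  have h3 : ‖z - z'‖ ≤ 0 := by
    by_contra h4
    push Not at h4
    have := mul_pos hb h4
    linarith
  exact sub_eq_zero.1 (norm_le_zero_iff.1 h3)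

/-- … and its inverse is bounded by `1/b`: `‖g⁻¹ u‖ ≤ ‖u‖ / b`. [folklore] -/
theorem norm_inv_mulVec_le {b : ℝ} (hb : 0 < b) {g : Matrix ι ι ℂ}
    (hlow : ∀ z : ι → ℂ, b * ‖z‖ ≤ ‖g *ᵥ z‖) (u : ι → ℂ) : ‖g⁻¹ *ᵥ u‖ ≤ ‖u‖ / b := by
  have hdet := isUnit_det_of_lower hb hlow
  have h := hlow (g⁻¹ *ᵥ u)
  rw [mulVec_mulVec, mul_nonsing_inv g hdet, one_mulVec] at h
  rw [le_div_iff₀ hb, mul_comm]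
  exact h

/-! ### Step 1 of the proof of Proposition 9: a small neighbourhood -/

/-- **Step 1 ([BookerThorne2014], proof of Prop. 9, (it_small_neigh)).** If `g₁` is bounded
below by `b > 0` in the sup norm and `g₂` is close to `g₁` (`‖(g₂ − g₁) z‖ ≤ (b/3)‖z‖`), then
every `y` with `‖y − g₁(1,…,1)‖ ≤ b/3` is `g₁ t₁ + g₂ t₂` with `t₁, t₂ ∈ T = {|t_i| = 1}`:
writing `Δ = g₁⁻¹ g₂ − I`, the continuous map `h_w(z) = w − Δ t₂(z)` of the polydisc
`B^n = {|z_i − 1| ≤ 2/3}` into itself has a fixed point by Brouwer's theorem, where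
`z = t₁(z) + t₂(z)` is the continuous decomposition into unit vectors.
[cite: BookerThorne2014, proof of Prop. 9, step 1] -/
theorem step1 [Nonempty ι] {b : ℝ} (hb : 0 < b) {g₁ g₂ : Matrix ι ι ℂ}
    (hlow : ∀ z : ι → ℂ, b * ‖z‖ ≤ ‖g₁ *ᵥ z‖)
    (hclose : ∀ z : ι → ℂ, ‖(g₂ - g₁) *ᵥ z‖ ≤ b / 3 * ‖z‖)
    {y : ι → ℂ} (hy : ‖y - g₁ *ᵥ (fun _ ↦ 1)‖ ≤ b / 3) :
    ∃ t₁ t₂ : ι → ℂ, (∀ i, ‖t₁ i‖ = 1) ∧ (∀ i, ‖t₂ i‖ = 1) ∧ g₁ *ᵥ t₁ + g₂ *ᵥ t₂ = y := by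
  have hdet := isUnit_det_of_lower hb hlow
  obtain ⟨s₁, s₂, hs₁c, hs₂c, hs⟩ := exists_unit_decomposition
  -- `w = g₁⁻¹ y`, `Δ u = g₁⁻¹ (g₂ - g₁) u`
  set ones : ι → ℂ := fun _ ↦ 1 with hones
  set w : ι → ℂ := g₁⁻¹ *ᵥ y with hw
  have hgw : g₁ *ᵥ w = y := by rw [hw, mulVec_mulVec, mul_nonsing_inv g₁ hdet, one_mulVec]
  have hw1 : ‖w - ones‖ ≤ 1 / 3 := by
    have : w - ones = g₁⁻¹ *ᵥ (y - g₁ *ᵥ ones) := by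
      rw [mulVec_sub, mulVec_mulVec, nonsing_inv_mul g₁ hdet, one_mulVec]
    rw [this]
    refine (norm_inv_mulVec_le hb hlow _).trans ?_
    rw [div_le_iff₀ hb]
    linarith
  set Δ : (ι → ℂ) → (ι → ℂ) := fun u ↦ g₁⁻¹ *ᵥ ((g₂ - g₁) *ᵥ u) with hΔ
  have hΔle : ∀ u, ‖Δ u‖ ≤ ‖u‖ / 3 := by
    intro u
    refine (norm_inv_mulVec_le hb hlow _).trans ?_
    rw [div_le_div_iff₀ hb (by norm_num : (0 : ℝ) < 3)]
    have := hclose u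
    nlinarith
  have hΔcont : Continuous Δ := by
    have : Δ = fun u ↦ (g₁⁻¹ * (g₂ - g₁)) *ᵥ u := by
      funext u; simp [hΔ, mulVec_mulVec]
    rw [this]
    exact LinearMap.continuous_of_finiteDimensional (Matrix.mulVecLin (g₁⁻¹ * (g₂ - g₁)))
  -- the polydisc `B = closedBall ones (2/3)`: its points have entries in `[1/3, 5/3]`
  have hBentry : ∀ z ∈ closedBall ones (2 / 3 : ℝ), ∀ i, z i ≠ 0 ∧ ‖z i‖ ≤ 2 := by
    intro z hz i
    rw [mem_closedBall, dist_eq_norm] at hz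
    have h1 : ‖z i - 1‖ ≤ 2 / 3 := (norm_le_pi_norm (z - ones) i).trans hz
    constructor
    · intro h0
      rw [h0, zero_sub, norm_neg, norm_one] at h1
      norm_num at h1
    · have := norm_le_norm_add_norm_sub' (z i) 1
      rw [norm_one] at this
      linarith
  -- the Brouwer map
  set H : (ι → ℂ) → (ι → ℂ) := fun z ↦ w - Δ (fun i ↦ s₂ (z i)) with hH
  have ht₂cont : ContinuousOn (fun z : ι → ℂ ↦ fun i ↦ s₂ (z i)) (closedBall ones (2 / 3)) := by
    rw [continuousOn_pi]
    intro i
    exact hs₂c.comp (continuous_apply i).continuousOn fun z hz ↦ (hBentry z hz i).1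
  have hHcont : ContinuousOn H (closedBall ones (2 / 3)) :=
    continuousOn_const.sub (hΔcont.comp_continuousOn ht₂cont)
  have hHmaps : MapsTo H (closedBall ones (2 / 3)) (closedBall ones (2 / 3)) := by
    intro z hz
    have hunit : ∀ i, ‖s₂ (z i)‖ = 1 := fun i ↦ (hs (z i) (hBentry z hz i).1 (hBentry z hz i).2).2.1
    rw [mem_closedBall, dist_eq_norm]
    have hHz : H z - ones = (w - ones) - Δ (fun i ↦ s₂ (z i)) := by
      rw [hH]; dsimp only; abel
    calc ‖H z - ones‖ = ‖(w - ones) - Δ (fun i ↦ s₂ (z i))‖ := by rw [hHz]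
      _ ≤ ‖w - ones‖ + ‖Δ (fun i ↦ s₂ (z i))‖ := norm_sub_le _ _
      _ ≤ 1 / 3 + ‖(fun i ↦ s₂ (z i))‖ / 3 := add_le_add hw1 (hΔle _)
      _ = 1 / 3 + 1 / 3 := by rw [norm_eq_one_of_forall_norm_eq_one hunit]
      _ ≤ 2 / 3 := by norm_num
  obtain ⟨z, hz, hfix⟩ := Literature.Topology.Euclidean.Brouwer.exists_fixedPoint_closedBall_of_finiteDimensional
    (by norm_num : (0 : ℝ) ≤ 2 / 3) hHcont hHmaps
  -- read off `t₁, t₂`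
  have hz' := hBentry z hz
  refine ⟨fun i ↦ s₁ (z i), fun i ↦ s₂ (z i), fun i ↦ (hs (z i) (hz' i).1 (hz' i).2).1,
    fun i ↦ (hs (z i) (hz' i).1 (hz' i).2).2.1, ?_⟩
  have hsum : (fun i ↦ s₁ (z i)) + (fun i ↦ s₂ (z i)) = z :=
    funext fun i ↦ (hs (z i) (hz' i).1 (hz' i).2).2.2
  have hzw : z + Δ (fun i ↦ s₂ (z i)) = w := by
    have hfix' : w - Δ (fun i ↦ s₂ (z i)) = z := hfix
    exact (sub_eq_iff_eq_add.1 hfix').symm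
  calc g₁ *ᵥ (fun i ↦ s₁ (z i)) + g₂ *ᵥ (fun i ↦ s₂ (z i))
      = g₁ *ᵥ ((fun i ↦ s₁ (z i)) + (fun i ↦ s₂ (z i))) + (g₂ - g₁) *ᵥ (fun i ↦ s₂ (z i)) := by
        rw [mulVec_add, sub_mulVec]; abel
    _ = g₁ *ᵥ z + g₁ *ᵥ (Δ (fun i ↦ s₂ (z i))) := by
        rw [hsum, hΔ]
        simp only
        rw [mulVec_mulVec, mul_nonsing_inv g₁ hdet, one_mulVec]
    _ = g₁ *ᵥ w := by rw [← mulVec_add, hzw]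
    _ = y := hgw

/-! ### A block of matrices containing a close pair realizes a small ball -/

/-- **From step 1 to a block.** If a family `g_j` (`j < m₁`) of matrices bounded above by `A` in
the sup norm contains two indices `j₁ ≠ j₂` with `g_{j₁}` bounded below by `b` and `g_{j₂}` close
to `g_{j₁}`, then all of the ball `‖y − v‖ ≤ b/3` about `v = ∑_{j ≠ j₂} g_j (1,…,1)` (so
`‖v‖ ≤ m₁ A`) consists of sums `∑_j g_j t_j` with `t_j ∈ T` ("choosing arbitrary fixed
`t_3, …, t_m ∈ T`", [BookerThorne2014], proof of Prop. 9, end of step 1).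
[cite: BookerThorne2014, proof of Prop. 9, step 1] -/
theorem block_ball [Nonempty ι] {A b : ℝ} (hA : 0 ≤ A) (hb : 0 < b) {m₁ : ℕ}
    (g : Fin m₁ → Matrix ι ι ℂ) (hup : ∀ j z, ‖g j *ᵥ z‖ ≤ A * ‖z‖)
    {j₁ j₂ : Fin m₁} (hne : j₁ ≠ j₂) (hlow : ∀ z : ι → ℂ, b * ‖z‖ ≤ ‖g j₁ *ᵥ z‖)
    (hclose : ∀ z : ι → ℂ, ‖(g j₂ - g j₁) *ᵥ z‖ ≤ b / 3 * ‖z‖) :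
    ∃ v : ι → ℂ, ‖v‖ ≤ m₁ * A ∧ ∀ y : ι → ℂ, ‖y - v‖ ≤ b / 3 →
      ∃ t : Fin m₁ → ι → ℂ, (∀ j i, ‖t j i‖ = 1) ∧ ∑ j, g j *ᵥ t j = y := by
  classical
  set ones : ι → ℂ := fun _ ↦ 1 with hones
  set R : Finset (Fin m₁) := (Finset.univ.erase j₁).erase j₂ with hR
  have hj₂ : j₂ ∈ Finset.univ.erase j₁ := Finset.mem_erase.2 ⟨hne.symm, Finset.mem_univ _⟩
  have hsplit : ∀ f : Fin m₁ → ι → ℂ, ∑ j, f j = f j₁ + (f j₂ + ∑ j ∈ R, f j) := by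
    intro f
    rw [← Finset.add_sum_erase _ f (Finset.mem_univ j₁), ← Finset.add_sum_erase _ f hj₂]
  have hRne : ∀ j ∈ R, j ≠ j₁ ∧ j ≠ j₂ := by
    intro j hj
    simp only [hR, Finset.mem_erase] at hj
    exact ⟨hj.2.1, hj.1⟩
  -- the centre
  set v : ι → ℂ := g j₁ *ᵥ ones + ∑ j ∈ R, g j *ᵥ ones with hv
  have hgones : ∀ j, ‖g j *ᵥ ones‖ ≤ A := fun j ↦ by
    have := hup j ones
    rwa [norm_ones, mul_one] at this
  have hvnorm : ‖v‖ ≤ m₁ * A := by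
    have hRcard : (R.card : ℝ) + 1 ≤ m₁ := by
      have h1 : R.card + 1 + 1 = Fintype.card (Fin m₁) := by
        rw [hR, Finset.card_erase_of_mem (Finset.mem_erase.2 ⟨hne.symm, Finset.mem_univ _⟩),
          Finset.card_erase_of_mem (Finset.mem_univ _), Finset.card_univ]
        have : 2 ≤ Fintype.card (Fin m₁) := by
          rw [← Finset.card_univ]
          exact Finset.one_lt_card.2 ⟨j₁, Finset.mem_univ _, j₂, Finset.mem_univ _, hne⟩
        omega
      rw [Fintype.card_fin] at h1
      have : (R.card : ℝ) + 1 + 1 = m₁ := by exact_mod_cast h1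
      linarith
    calc ‖v‖ ≤ ‖g j₁ *ᵥ ones‖ + ‖∑ j ∈ R, g j *ᵥ ones‖ := norm_add_le _ _
      _ ≤ A + ∑ j ∈ R, ‖g j *ᵥ ones‖ := add_le_add (hgones _) (norm_sum_le _ _)
      _ ≤ A + ∑ _j ∈ R, A := by gcongr with j hj; exact hgones j
      _ = (R.card + 1) * A := by rw [Finset.sum_const, nsmul_eq_mul]; ring
      _ ≤ m₁ * A := mul_le_mul_of_nonneg_right hRcard hA
  refine ⟨v, hvnorm, fun y hy ↦ ?_⟩
  -- solve for the pair
  set y' : ι → ℂ := y - ∑ j ∈ R, g j *ᵥ ones with hy'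
  have hy'1 : ‖y' - g j₁ *ᵥ ones‖ ≤ b / 3 := by
    have : y' - g j₁ *ᵥ ones = y - v := by rw [hy', hv]; abel
    rwa [this]
  obtain ⟨t₁, t₂, ht₁, ht₂, hsum⟩ := step1 hb hlow hclose hy'1
  refine ⟨fun j ↦ if j = j₁ then t₁ else if j = j₂ then t₂ else ones, fun j i ↦ ?_, ?_⟩
  · dsimp only
    split_ifs
    · exact ht₁ i
    · exact ht₂ i
    · simp [hones]
  · have e1 : (g j₁ *ᵥ if j₁ = j₁ then t₁ else if j₁ = j₂ then t₂ else ones) = g j₁ *ᵥ t₁ := by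
      rw [if_pos rfl]
    have e2 : (g j₂ *ᵥ if j₂ = j₁ then t₁ else if j₂ = j₂ then t₂ else ones) = g j₂ *ᵥ t₂ := by
      rw [if_neg hne.symm, if_pos rfl]
    have hrest : ∑ j ∈ R, g j *ᵥ (if j = j₁ then t₁ else if j = j₂ then t₂ else ones) =
        ∑ j ∈ R, g j *ᵥ ones := by
      refine Finset.sum_congr rfl fun j hj ↦ ?_
      rw [if_neg (hRne j hj).1, if_neg (hRne j hj).2]
    rw [hsplit]
    dsimp only
    rw [e1, e2, hrest, ← add_assoc, hsum, hy']
    abel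

/-! ### Compactness: among many bounded matrices two are close -/

section Net

attribute [local instance] Matrix.normedAddCommGroup Matrix.normedSpace

/-- Entries of a matrix bounded by `A` in the sup operator sense are bounded by `A`. [folklore] -/
theorem norm_entry_le_of_mulVec_le {A : ℝ} {g : Matrix ι ι ℂ}
    (hup : ∀ z : ι → ℂ, ‖g *ᵥ z‖ ≤ A * ‖z‖) (i j : ι) : ‖g i j‖ ≤ A := by
  have h := hup (Pi.single j 1)
  rw [mulVec_single_one, Pi.norm_single, norm_one, mul_one] at h
  exact (norm_le_pi_norm (g.col j) i).trans h

/-- **Pigeonhole on a compact set of matrices** ([BookerThorne2014], proof of Prop. 9, step 1: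
"By compactness, there is an `m_1` such that for any `m ≥ m_1` and any `m`-tuple
`(g_1, …, g_m)`, there is a distinct pair of indices `i, j` such that `‖g_i^{-1} g_j − I‖` is
small"): there is `m₁ ≥ 2` such that among any `m₁` matrices bounded by `A` in the sup norm two
(with distinct indices) differ by an operator of sup norm at most `b/3`.
[cite: BookerThorne2014, proof of Prop. 9, step 1] -/
theorem exists_close_pair_card (A : ℝ) {b : ℝ} (hb : 0 < b) :
    ∃ m₁ : ℕ, 2 ≤ m₁ ∧ ∀ g : Fin m₁ → Matrix ι ι ℂ, (∀ j z, ‖g j *ᵥ z‖ ≤ A * ‖z‖) →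
      ∃ j₁ j₂ : Fin m₁, j₁ ≠ j₂ ∧ ∀ z : ι → ℂ, ‖(g j₂ - g j₁) *ᵥ z‖ ≤ b / 3 * ‖z‖ := by
  classical
  rcases isEmpty_or_nonempty ι with hι | hι
  · refine ⟨2, le_rfl, fun g _ ↦ ⟨0, 1, by decide, fun z ↦ ?_⟩⟩
    have : z = 0 := Subsingleton.elim _ _
    simp [this]
  -- the compact set of entrywise-bounded matrices and a finite cover by small balls
  set n : ℕ := Fintype.card ι with hn
  have hn1 : (1 : ℝ) ≤ n := by
    have : 1 ≤ n := Fintype.card_pos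
    exact_mod_cast this
  set e : ℝ := b / (6 * n) with he
  have he0 : 0 < e := by positivity
  obtain ⟨t, -, htfin, hcover⟩ :=
    finite_cover_balls_of_compact (isCompact_closedBall (0 : Matrix ι ι ℂ) (max A 0)) he0
  set m₁ : ℕ := htfin.toFinset.card + 2 with hm₁
  refine ⟨m₁, by omega, fun g hg ↦ ?_⟩
  -- each `g j` lies in the compact set, hence in some ball of the cover
  have hmem : ∀ j, g j ∈ closedBall (0 : Matrix ι ι ℂ) (max A 0) := by
    intro j
    rw [mem_closedBall_zero_iff, Matrix.norm_le_iff (le_max_right _ _)]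
    intro i i'
    exact (norm_entry_le_of_mulVec_le (hg j) i i').trans (le_max_left _ _)
  have hcenter : ∀ j, ∃ c ∈ htfin.toFinset, g j ∈ ball c e := by
    intro j
    have := hcover (hmem j)
    rw [Set.mem_iUnion₂] at this
    obtain ⟨c, hc, hjc⟩ := this
    exact ⟨c, htfin.mem_toFinset.2 hc, hjc⟩
  choose c hc hgc using hcenter
  obtain ⟨j₁, -, j₂, -, hne, hceq⟩ := Finset.exists_ne_map_eq_of_card_lt_of_maps_to
    (s := (Finset.univ : Finset (Fin m₁))) (t := htfin.toFinset)
    (by rw [Finset.card_univ, Fintype.card_fin, hm₁]; omega) (fun j _ ↦ hc j)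
  refine ⟨j₁, j₂, hne, fun z ↦ ?_⟩
  -- the two matrices are within `2e` entrywise
  have hdist : ‖g j₂ - g j₁‖ < 2 * e := by
    have h1 : dist (g j₁) (c j₁) < e := hgc j₁
    have h2 : dist (g j₂) (c j₂) < e := hgc j₂
    rw [← hceq] at h2
    rw [← dist_eq_norm]
    calc dist (g j₂) (g j₁) ≤ dist (g j₂) (c j₁) + dist (g j₁) (c j₁) := dist_triangle_right _ _ _
      _ < e + e := add_lt_add h2 h1
      _ = 2 * e := by ring
  have hentry : ∀ i i', ‖(g j₂ - g j₁) i i'‖ ≤ 2 * e := fun i i' ↦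
    ((Matrix.norm_entry_le_entrywise_sup_norm (g j₂ - g j₁)).trans hdist.le)
  calc ‖(g j₂ - g j₁) *ᵥ z‖ ≤ n * (2 * e) * ‖z‖ := norm_mulVec_le_of_entry_le (by positivity) hentry z
    _ = b / 3 * ‖z‖ := by rw [he, hn]; field_simp; ring

end Net


/-! ### Step 2 of the proof of Proposition 9: the ball of radius `2` -/

/-- **Step 2 ([BookerThorne2014], proof of Prop. 9, (it_big_neigh)).** Suppose that every
`m₁`-block of matrices bounded by `A` contains a close pair (as provided by
`exists_close_pair_card`). Then there is `K₁` such that for every family `G` of `K₁ m₁` matrices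
bounded above by `A` and below by `b`, every `y` with `‖y‖_∞ ≤ 2` is `∑ G_{jl} t_{jl}` with
`t_{jl} ∈ T`: block `j` realizes a ball of radius `b/3` about a centre `v_j` with
`‖v_j‖ ≤ m₁ A`; flipping the blocks by signs `ε_j` with `‖∑ ε_j v_j‖ ≤ √(K₁ n) m₁ A` (Lemma 5)
the blocks together realize the ball of radius `K₁ b/3 − √(K₁ n) m₁ A ≥ 2` about `0`.
[cite: BookerThorne2014, proof of Prop. 9, step 2] -/
theorem step2 [Nonempty ι] {A b : ℝ} (hA : 0 ≤ A) (hb : 0 < b) {m₁ : ℕ}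
    (hpair : ∀ g : Fin m₁ → Matrix ι ι ℂ, (∀ j z, ‖g j *ᵥ z‖ ≤ A * ‖z‖) →
      ∃ j₁ j₂ : Fin m₁, j₁ ≠ j₂ ∧ ∀ z : ι → ℂ, ‖(g j₂ - g j₁) *ᵥ z‖ ≤ b / 3 * ‖z‖) :
    ∃ K₁ : ℕ, ∀ G : Fin K₁ × Fin m₁ → Matrix ι ι ℂ,
      (∀ x z, ‖G x *ᵥ z‖ ≤ A * ‖z‖) → (∀ x z, b * ‖z‖ ≤ ‖G x *ᵥ z‖) →
      ∀ y : ι → ℂ, ‖y‖ ≤ 2 →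
        ∃ t : Fin K₁ × Fin m₁ → ι → ℂ, (∀ x i, ‖t x i‖ = 1) ∧ ∑ x, G x *ᵥ t x = y := by
  classical
  set n : ℕ := Fintype.card ι with hn
  set C : ℝ := m₁ * A with hC
  have hC0 : 0 ≤ C := by positivity
  -- the number of blocks
  set K₁ : ℕ := ⌈36 * n * C ^ 2 / b ^ 2 + 12 / b⌉₊ + 1 with hK₁
  have hK₁pos : 0 < K₁ := Nat.succ_pos _
  have hK₁real : 36 * n * C ^ 2 / b ^ 2 + 12 / b ≤ K₁ := by
    rw [hK₁]
    push_cast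
    linarith [Nat.le_ceil (36 * n * C ^ 2 / b ^ 2 + 12 / b)]
  have hpos1 : (0 : ℝ) ≤ 36 * n * C ^ 2 / b ^ 2 := by positivity
  have hpos2 : (0 : ℝ) ≤ 12 / b := by positivity
  have hK₁1 : 36 * n * C ^ 2 / b ^ 2 ≤ K₁ := by linarith
  have hK₁2 : 12 / b ≤ K₁ := by linarith
  have hK₁0 : (0 : ℝ) ≤ K₁ := by positivity
  -- the key inequality `2 + √(K₁ n) C ≤ K₁ b / 3`
  have hkey : 2 + Real.sqrt (K₁ * n) * C ≤ K₁ * (b / 3) := by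
    have h36 : 36 * n * C ^ 2 ≤ K₁ * b ^ 2 := by rwa [div_le_iff₀ (by positivity)] at hK₁1
    have h1 : Real.sqrt (K₁ * n) * C ≤ K₁ * b / 6 := by
      rw [← Real.sqrt_sq hC0, ← Real.sqrt_mul (by positivity), Real.sqrt_le_iff]
      refine ⟨by positivity, ?_⟩
      nlinarith
    have h2 : (2 : ℝ) ≤ K₁ * b / 6 := by
      rw [div_le_iff₀ hb] at hK₁2
      nlinarith
    linarith
  refine ⟨K₁, fun G hGup hGlow y hy ↦ ?_⟩
  -- block centres
  have hblock : ∀ j : Fin K₁, ∃ v : ι → ℂ, ‖v‖ ≤ C ∧ ∀ y' : ι → ℂ, ‖y' - v‖ ≤ b / 3 →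
      ∃ t : Fin m₁ → ι → ℂ, (∀ l i, ‖t l i‖ = 1) ∧ ∑ l, G (j, l) *ᵥ t l = y' := by
    intro j
    obtain ⟨j₁, j₂, hne, hclose⟩ := hpair (fun l ↦ G (j, l)) (fun l z ↦ hGup (j, l) z)
    exact block_ball hA hb (fun l ↦ G (j, l)) (fun l z ↦ hGup (j, l) z) hne
      (fun z ↦ hGlow (j, j₁) z) hclose
  choose v hvC hvball using hblock
  -- signs
  obtain ⟨e, he, hev⟩ := exists_signs_norm_sum_le K₁ v hC0 hvC
  have he1 : ∀ j, ‖(e j : ℂ)‖ = 1 := fun j ↦ by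
    rcases he j with h | h <;> simp [h]
  have he2 : ∀ j, (e j : ℂ) * (e j : ℂ) = 1 := fun j ↦ by
    rcases he j with h | h <;> simp [h]
  -- the remainder, split evenly among the blocks
  set u : ι → ℂ := y - ∑ j, (e j : ℂ) • v j with hu
  have hunorm : ‖u‖ ≤ K₁ * (b / 3) := by
    calc ‖u‖ ≤ ‖y‖ + ‖∑ j, (e j : ℂ) • v j‖ := norm_sub_le _ _
      _ ≤ 2 + Real.sqrt (K₁ * n) * C := add_le_add hy (by simpa [hn] using hev)
      _ ≤ K₁ * (b / 3) := hkey
  set u' : ι → ℂ := (K₁ : ℂ)⁻¹ • u with hu'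
  have hu'norm : ‖u'‖ ≤ b / 3 := by
    rw [hu', norm_smul, norm_inv, Complex.norm_natCast]
    rw [inv_mul_le_iff₀ (by exact_mod_cast hK₁pos)]
    exact hunorm
  -- solve in each block for `v j + e j • u'`
  have htarget : ∀ j, ‖(v j + (e j : ℂ) • u') - v j‖ ≤ b / 3 := by
    intro j
    rw [add_sub_cancel_left, norm_smul, he1, one_mul]
    exact hu'norm
  choose t ht htsum using fun j ↦ hvball j _ (htarget j)
  refine ⟨fun x ↦ (e x.1 : ℂ) • t x.1 x.2, fun x i ↦ ?_, ?_⟩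
  · dsimp only
    rw [Pi.smul_apply, smul_eq_mul, norm_mul, he1, one_mul, ht]
  · show ∑ x, G x *ᵥ ((e x.1 : ℂ) • t x.1 x.2) = y
    rw [Fintype.sum_prod_type]
    dsimp only
    simp_rw [mulVec_smul, ← Finset.smul_sum, htsum, smul_add, smul_smul, he2, one_smul]
    rw [Finset.sum_add_distrib, Finset.sum_const, Finset.card_univ, Fintype.card_fin]
    have hKu : K₁ • u' = u := by
      rw [hu', ← Nat.cast_smul_eq_nsmul ℂ, smul_smul,
        mul_inv_cancel₀ (by exact_mod_cast hK₁pos.ne'), one_smul]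
    rw [hKu, hu]
    abel

/-! ### Proposition 9 -/

/-- The vector `2 e_i` has sup norm `2`. [folklore] -/
theorem norm_two_smul_single (i : ι) : ‖(2 : ℂ) • (Pi.single i (1 : ℂ) : ι → ℂ)‖ = 2 := by
  rw [norm_smul, Pi.norm_single, norm_one, mul_one]
  norm_num

/-- **Booker–Thorne 2014, Proposition 9** (for the compact set
`K = {g : ‖g z‖_∞ ≤ A‖z‖_∞, ‖g z‖_∞ ≥ b‖z‖_∞}` of `GL_n(ℂ)`, `n = |ι|`, and a fixed number of
matrices): "Let `T = {(z_1,…,z_n) ∈ ℂⁿ : |z_1| = … = |z_n| = 1}`,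
`D = {(z_1,…,z_n) ∈ ℂⁿ : |z_1|, …, |z_n| ≤ 1}`, and fix a compact set `K ⊆ GL_n(ℂ)`. Then there is
a number `m_0 > 0` such that for every `m ≥ m_0` and all `(g_1,…,g_m) ∈ K^m`, there are
continuous functions `f_1, …, f_m : D → T` such that `∑_{i=1}^m g_i f_i(z) = z` for all
`z ∈ D`." Here the `m = 3 n K₁ m₁` matrices are indexed by `(ι × Fin 3) × (Fin K₁ × Fin m₁)`, `D`
is the closed unit ball of `ι → ℂ` in the sup norm, and `f_x(z) ∈ T` is `∀ i, ‖f x z i‖ = 1`.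
Proof as printed: steps 1–2 (`step1`, `block_ball`, `exists_close_pair_card`, `step2`) give, for
each `(i, ℓ)`, phases `t^{(iℓ)}` with `∑ g t^{(iℓ)} = 2e_i`; for `z ∈ D` write
`z_i = 2(1 + α_i(z) + β_i(z))` with `α_i, β_i` unit and continuous (`exists_unit_decomposition`
at `z_i/2 − 1`), and put `f = t^{(i0)}`, `α_i t^{(i1)}`, `β_i t^{(i2)}` on the three copies.
[cite: BookerThorne2014, Prop. 9] -/
theorem prop9 (A : ℝ) {b : ℝ} (hA : 0 ≤ A) (hb : 0 < b) :
    ∃ K₁ m₁ : ℕ, ∀ g : (ι × Fin 3) × (Fin K₁ × Fin m₁) → Matrix ι ι ℂ,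
      (∀ x z, ‖g x *ᵥ z‖ ≤ A * ‖z‖) → (∀ x z, b * ‖z‖ ≤ ‖g x *ᵥ z‖) →
      ∃ f : ((ι × Fin 3) × (Fin K₁ × Fin m₁)) → (ι → ℂ) → (ι → ℂ),
        (∀ x, ContinuousOn (f x) (closedBall 0 1)) ∧
        (∀ x, ∀ z ∈ closedBall (0 : ι → ℂ) 1, ∀ i, ‖f x z i‖ = 1) ∧
        ∀ z ∈ closedBall (0 : ι → ℂ) 1, ∑ x, g x *ᵥ f x z = z := by
  classical
  rcases isEmpty_or_nonempty ι with hι | hι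
  · refine ⟨0, 0, fun g _ _ ↦ ⟨fun _ z ↦ z, fun _ ↦ continuousOn_id, fun _ _ _ i ↦ isEmptyElim i,
      fun z _ ↦ Subsingleton.elim _ _⟩⟩
  obtain ⟨m₁, -, hpair⟩ := exists_close_pair_card (ι := ι) A hb
  obtain ⟨K₁, hK₁⟩ := step2 hA hb hpair
  refine ⟨K₁, m₁, fun g hup hlow ↦ ?_⟩
  -- phases realizing `2 e_i` on the sub-family `(i, ℓ)`
  have hT : ∀ a : ι × Fin 3, ∃ t : Fin K₁ × Fin m₁ → ι → ℂ, (∀ x i, ‖t x i‖ = 1) ∧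
      ∑ x, g (a, x) *ᵥ t x = (2 : ℂ) • Pi.single a.1 (1 : ℂ) := fun a ↦
    hK₁ (fun x ↦ g (a, x)) (fun x z ↦ hup (a, x) z) (fun x z ↦ hlow (a, x) z) _
      (norm_two_smul_single a.1).le
  choose t ht htsum using hT
  obtain ⟨s₁, s₂, hs₁c, hs₂c, hs⟩ := exists_unit_decomposition
  -- the points `z_i/2 - 1`
  have hw : ∀ z ∈ closedBall (0 : ι → ℂ) 1, ∀ i, z i / 2 - 1 ≠ 0 ∧ ‖z i / 2 - 1‖ ≤ 2 := by
    intro z hz i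
    rw [mem_closedBall_zero_iff] at hz
    have hzi : ‖z i‖ ≤ 1 := (norm_le_pi_norm z i).trans hz
    have h1 : 1 / 2 ≤ ‖z i / 2 - 1‖ := by
      have := norm_sub_norm_le (1 : ℂ) (z i / 2)
      rw [norm_one, norm_div, Complex.norm_two, norm_sub_rev] at this
      linarith
    constructor
    · intro h0
      rw [h0, norm_zero] at h1
      norm_num at h1
    · calc ‖z i / 2 - 1‖ ≤ ‖z i / 2‖ + ‖(1 : ℂ)‖ := norm_sub_le _ _
        _ ≤ 1 / 2 + 1 := by rw [norm_div, Complex.norm_two, norm_one]; linarith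
        _ ≤ 2 := by norm_num
  -- the phase functions
  set φ : ι × Fin 3 → (ι → ℂ) → ℂ := fun a z ↦
    ![(1 : ℂ), s₁ (z a.1 / 2 - 1), s₂ (z a.1 / 2 - 1)] a.2 with hφ
  have hφcont : ∀ a, ContinuousOn (φ a) (closedBall 0 1) := by
    rintro ⟨i, l⟩
    have hlin : Continuous fun z : ι → ℂ ↦ z i / 2 - 1 :=
      ((continuous_apply i).div_const 2).sub continuous_const
    fin_cases l
    · simp only [hφ]
      exact continuousOn_const
    · simp only [hφ]
      exact hs₁c.comp hlin.continuousOn fun z hz ↦ (hw z hz i).1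
    · simp only [hφ]
      exact hs₂c.comp hlin.continuousOn fun z hz ↦ (hw z hz i).1
  have hφunit : ∀ a, ∀ z ∈ closedBall (0 : ι → ℂ) 1, ‖φ a z‖ = 1 := by
    rintro ⟨i, l⟩ z hz
    obtain ⟨h1, h2, -⟩ := hs _ (hw z hz i).1 (hw z hz i).2
    fin_cases l
    · simp [hφ]
    · simpa [hφ] using h1
    · simpa [hφ] using h2
  have hφsum : ∀ z ∈ closedBall (0 : ι → ℂ) 1, ∀ i, ∑ l : Fin 3, φ (i, l) z = z i / 2 := by
    intro z hz i
    obtain ⟨-, -, h3⟩ := hs _ (hw z hz i).1 (hw z hz i).2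
    rw [Fin.sum_univ_three]
    simp only [hφ, Matrix.cons_val_zero, Matrix.cons_val_one, Matrix.cons_val_two,
      Matrix.head_cons, Matrix.tail_cons]
    rw [add_assoc, h3]
    ring
  -- the functions `f`
  refine ⟨fun x z ↦ φ x.1 z • t x.1 x.2, fun x ↦ (hφcont x.1).smul continuousOn_const,
    fun x z hz i ↦ ?_, fun z hz ↦ ?_⟩
  · dsimp only
    rw [Pi.smul_apply, smul_eq_mul, norm_mul, hφunit x.1 z hz, one_mul, ht]
  · show ∑ x, g x *ᵥ (φ x.1 z • t x.1 x.2) = z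
    rw [Fintype.sum_prod_type]
    dsimp only
    simp_rw [mulVec_smul, ← Finset.smul_sum, htsum]
    rw [Fintype.sum_prod_type]
    dsimp only
    simp_rw [← Finset.sum_smul, hφsum z hz, smul_smul]
    have h2 : ∀ i, z i / 2 * 2 = z i := fun i ↦ by ring
    simp_rw [h2]
    have hsingle : ∀ i, z i • (Pi.single i (1 : ℂ) : ι → ℂ) = Pi.single i (z i) := by
      intro i
      ext j
      simp [Pi.single_apply]
    simp_rw [hsingle]
    exact Finset.univ_sum_single z


end BookerThorne2014

end Literature.Barriers.RiemannHypothesis
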